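import Literature.AlgebraicGeometry.Resolution.KaplanskyUnitForms
import Literature.AlgebraicGeometry.Resolution.RoofInField
import HarnessLib

/-!
# Coefficients in the disc chart `m°[x′][1/u]` from Kaplansky unit forms

Topic: `Literature/AlgebraicGeometry/Resolution` (valued function fields). Provider-side toolkit
for the E-data of the chart datum of M. Temkin, *Inseparable local uniformization*, J. Algebra
373 (2013), Thm. 3.3.1 (tree: `RelCurveChart.EData`, `DChartRoof.lean`; the E-chart
`exists_EChart`, `EChart.lean`, asks for the coefficients of the local-étale data in the ring
`locAway (adjoin m° {x′}) u` for a `V`-unit `u ∈ m°[x′]`). If `P, Q` are polynomials over `m`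
with Kaplansky unit forms `U_P, U_Q` at the centre `(a₀, c₀)` of the disc
(`KaplanskyUnitForms.lean`: `P(x) = P(a₀) U_P(x′)`, `U_P ≡ 1` a `1`-unit polynomial over `m`),
and `|P(x)/Q(x)| ≤ 1`, then `P(x)/Q(x) = (P(a₀)/Q(a₀)) · U_P(x′) · U_Q(x′)⁻¹` lies in
`m°[x′][1/u]` for every `u ∈ m°[x′]` divisible by `U_Q(x′)`:

* `eval_unitForm_mem_adjoin` — `U(x′) ∈ m°[x′]` — PROVED;
* `div_mem_locAway_adjoin_of_unitForms` — **the quotient lies in the disc chart** — PROVED;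
* `dvd_prod_of_mem` — each factor of a finite product divides it (for `u = ∏ U_Q(x′)`) — PROVED.

All statements are [folklore]; no definitions, no named facts.

## Sources

* F.-V. Kuhlmann, I. Vlahu, Math. Z. 276 (2014), Cor. 7.1 (unit forms), through the tree;
  M. Temkin, arXiv:0804.1554v3, proof of Thm. 3.3.1, Step 3 (the use). [Temkin2013]
-/

noncomputable section

open Polynomial

namespace Literature.AlgebraicGeometry.Resolution

universe u

variable {Ω : Type u} [Field Ω] (V : ValuationSubring Ω) (m : Subfield Ω)

/-- A `1`-unit polynomial over `m` (constant coefficient `1`, higher coefficients of value `< 1`)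
has its coefficients in `m° = O_V ∩ m`, hence its value at `x′` lies in `m°[x′]`. [folklore] -/
theorem eval_unitForm_mem_adjoin {U : Polynomial Ω} (hUm : ∀ i, U.coeff i ∈ m) (hU0 : U.coeff 0 = 1)
    (hUk : ∀ i, 1 ≤ i → V.valuation (U.coeff i) < 1) (x' : Ω) :
    U.eval x' ∈ Algebra.adjoin (V.toSubring ⊓ m.toSubring : Subring Ω) ({x'} : Set Ω) := by
  set S := Algebra.adjoin (V.toSubring ⊓ m.toSubring : Subring Ω) ({x'} : Set Ω) with hS
  have hcoef : ∀ i, U.coeff i ∈ S := by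
    intro i
    have hV : U.coeff i ∈ V := by
      rcases Nat.eq_zero_or_pos i with rfl | hi
      · rw [hU0]; exact V.one_mem
      · exact (V.valuation_le_one_iff _).mp (hUk i hi).le
    exact S.algebraMap_mem ⟨U.coeff i, Subring.mem_inf.mpr ⟨hV, hUm i⟩⟩
  rw [eval_eq_sum_range]
  exact S.sum_mem fun i _ => S.mul_mem (hcoef i) (S.pow_mem (Algebra.subset_adjoin rfl) i)

/-- A member of a finset divides the product over it, inside any commutative monoid. [folklore] -/
theorem dvd_prod_of_mem {ι M : Type*} [CommMonoid M] [DecidableEq ι] (s : Finset ι) (f : ι → M)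
    {i : ι} (hi : i ∈ s) : f i ∣ ∏ j ∈ s, f j := by
  rw [← Finset.mul_prod_erase s f hi]
  exact dvd_mul_right _ _

/-- **Unit-form quotients lie in the disc chart.** Let `P, Q` be polynomials over `m` with unit
forms `U_P, U_Q` at `(a₀, c₀)` (`P(x) = P(a₀) U_P(x′)`, `Q(x) = Q(a₀) U_Q(x′)`, `x′ = (x − a₀)/c₀`),
`Q(x) ≠ 0`, `|P(x)/Q(x)| ≤ 1`, `x′ ∈ O_V`, and let `u ∈ m°[x′]` be divisible by `U_Q(x′)` in
`m°[x′]`. Then `P(x)/Q(x) ∈ m°[x′][1/u]`. [folklore] -/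
theorem div_mem_locAway_adjoin_of_unitForms {x a₀ c₀ : Ω} (ha₀ : a₀ ∈ m)
    (hx'V : (x - a₀) / c₀ ∈ V)
    {P Q UP UQ : Polynomial Ω} (hPm : ∀ i, P.coeff i ∈ m) (hQm : ∀ i, Q.coeff i ∈ m)
    (hUPm : ∀ i, UP.coeff i ∈ m) (hUP0 : UP.coeff 0 = 1)
    (hUPk : ∀ i, 1 ≤ i → V.valuation (UP.coeff i) < 1)
    (hUQm : ∀ i, UQ.coeff i ∈ m) (hUQ0 : UQ.coeff 0 = 1)
    (hUQk : ∀ i, 1 ≤ i → V.valuation (UQ.coeff i) < 1)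
    (hP : P.eval x = P.eval a₀ * UP.eval ((x - a₀) / c₀))
    (hQ : Q.eval x = Q.eval a₀ * UQ.eval ((x - a₀) / c₀))
    (hQx : Q.eval x ≠ 0) (hle : V.valuation (P.eval x / Q.eval x) ≤ 1)
    {u : Ω} (hu : u ∈ Algebra.adjoin (V.toSubring ⊓ m.toSubring : Subring Ω) ({(x - a₀) / c₀} : Set Ω))
    (hdvd : ∃ w ∈ Algebra.adjoin (V.toSubring ⊓ m.toSubring : Subring Ω) ({(x - a₀) / c₀} : Set Ω),
      UQ.eval ((x - a₀) / c₀) * w = u)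
    (hu0 : u ≠ 0) :
    P.eval x / Q.eval x ∈
      locAway (Algebra.adjoin (V.toSubring ⊓ m.toSubring : Subring Ω) ({(x - a₀) / c₀} : Set Ω)) u hu := by
  set x' := (x - a₀) / c₀ with hx'
  set S := Algebra.adjoin (V.toSubring ⊓ m.toSubring : Subring Ω) ({x'} : Set Ω) with hS
  have hvUP : V.valuation (UP.eval x') = 1 :=
    valuation_eval_unitForm_eq_one V m hUPm hUP0 hUPk V (fun _ _ => Iff.rfl) hx'V
  have hvUQ : V.valuation (UQ.eval x') = 1 :=
    valuation_eval_unitForm_eq_one V m hUQm hUQ0 hUQk V (fun _ _ => Iff.rfl) hx'V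
  have hUQ0' : UQ.eval x' ≠ 0 := fun h0 => by rw [h0, map_zero] at hvUQ; exact zero_ne_one hvUQ
  have hQa₀ : Q.eval a₀ ≠ 0 := fun h0 => hQx (by rw [hQ, h0, zero_mul])
  set κ : Ω := P.eval a₀ / Q.eval a₀ with hκ
  have hκm : κ ∈ m :=
    m.div_mem (eval_mem_subfield_of_coeff_mem hPm ha₀) (eval_mem_subfield_of_coeff_mem hQm ha₀)
  have hq : P.eval x / Q.eval x = κ * UP.eval x' * (UQ.eval x')⁻¹ := by
    rw [hP, hQ, hκ]
    field_simp
  have hκV : κ ∈ V := by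
    rw [← V.valuation_le_one_iff]
    have h1 := hle
    rw [hq, map_mul, map_mul, map_inv₀, hvUP, hvUQ, inv_one, mul_one, mul_one] at h1
    exact h1
  have hκS : κ ∈ S := S.algebraMap_mem ⟨κ, Subring.mem_inf.mpr ⟨hκV, hκm⟩⟩
  have hUPS : UP.eval x' ∈ S := eval_unitForm_mem_adjoin V m hUPm hUP0 hUPk x'
  -- `U_Q(x′)⁻¹ = w · u⁻¹ ∈ S[1/u]`
  obtain ⟨w, hwS, hwu⟩ := hdvd
  have hinv : (UQ.eval x')⁻¹ = w * u⁻¹ := by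
    rw [eq_mul_inv_iff_mul_eq₀ hu0, ← hwu, ← mul_assoc, inv_mul_cancel₀ hUQ0', one_mul]
  rw [hq, hinv]
  exact (locAway S u hu).mul_mem
    ((locAway S u hu).mul_mem (le_locAway hκS) (le_locAway hUPS))
    ((locAway S u hu).mul_mem (le_locAway hwS) (inv_mem_locAway hu0))

end Literature.AlgebraicGeometry.Resolution

end
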